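import Mathlib
import HarnessLib

/-!
# `NoHeavyLowerTail` (crux stmt-CriticalPhenomena-4575), antithetic vdBHK programme: abstract LEG STRUCTURES and the strengthened routing
# statement (♮) of PROOF-RL-g43 — definitions

Definitions file (seat `prim-ineq-gen-7` gen 43; `--supports stmt-CriticalPhenomena-4575`).  Nothing is asserted about the crux; no `sorry`.
Memo: run/shared/lean/prim/prim-ineq-gen-7/PROOF-RL-g43.md (P1–P2), FINDING-PRODUCT-g43.md §7.

CONTEXT.  The ROUTING LEMMA `RL(F_v(T))` (for every up-set `R` and down-set `D` of the colouring poset of a rooted tree,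
`#{h ∈ D : K(h) ∩ R ≠ ∅} ≥ |R ∩ D|`) implies the typed per-tree inequality `(***)⁺⁺` (`AntitheticTypedProduct.typed_point`) and is multiplicative
(`AntitheticRoutingProduct.rl_product`); PROOF-RL-g43 proves it for every leg `f + E` by an induction over the HUB (root-edge subdivision) and NECK
(layered product) generation of the colouring posets, through the strengthened matching statement (♮).  This file fixes the ABSTRACT data the
induction runs on (PROOF-RL P1: labels = red edge sets `ρ ⊆ E`; `sub` = `⊆`; `ble`/`tle` = bottom/top orders; `blt ρ σ` = `b_ρ < t_σ`; `Φ` = the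
label map of `Φ` on bottoms) and the statement (♮), and the three constructors (2-chain, hub, neck).  The lemmas are in the sequels
`…AntitheticRoutingNeck` (`natural_leaf`, `natural_neck`) and `…AntitheticRoutingHub` (`natural_hub`).  That the colouring posets of legs are generated
from the 2-chain by `hub` and `neck` and satisfy the reflexivity axioms used there is PROOF-RL P1/P1″ (pencil; machine-checked on all legs ≤ 5 edges),
outside Lean as for every kernel of this programme.
* `AntitheticLegStr` — the five relations/maps;  `AntitheticLegStr.Natural` — (♮);  `AntitheticLegStr.hub`, `.neck`, `.leafStr` — the constructors.
-/

namespace Summit.CriticalPhenomena.PercolationContinuityZ3.Theorems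

/-- Abstract leg structure on a label type `Λ` (labels = red edge sets `ρ ⊆ E` of the colouring poset `F_v(f+E)`, PROOF-RL-g43 P1):
`sub ρ° ρ` (`ρ° ⊆ ρ`, the cube order), `ble` (bottom order: `ρ ⊆ ρ′ ∧ R(ρ) = R(ρ′)`), `tle` (top order), `blt ρ σ` (`b_ρ < t_σ`), `Φ` (the label map `Φ′`,
`Φ(b_ρ) = t_{Φ′ρ}`). [this work] -/
structure AntitheticLegStr (Λ : Type*) where
  /-- cube order on labels (`ρ° ⊆ ρ`) -/
  sub : Λ → Λ → Prop
  /-- bottom order (`b_ρ ≤ b_ρ′`) -/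
  ble : Λ → Λ → Prop
  /-- top order (`t_σ ≤ t_σ′`) -/
  tle : Λ → Λ → Prop
  /-- bottom-below-top relation (`b_ρ < t_σ`) -/
  blt : Λ → Λ → Prop
  /-- label map of `Φ` on bottoms (`Φ(b_ρ) = t_{Φ ρ}`) -/
  Φ : Λ → Λ

namespace AntitheticLegStr

variable {Λ : Type*}

/-- The strengthened routing statement (♮) of PROOF-RL-g43 P2 for an abstract leg structure: for all down-set data `Db ⊇ Dt`-closure
conditions and every admissible `Fs` (bottom-down-closed, containing every bottom below a top of `Dt`, inside `Db`) there is `M : Λ → Λ` which maps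
`A = Db \\ Dt` into `S = {s ∈ Db : Φ s ∉ Dt}` along `blt ρ (Φ (M ρ))`, injectively on `A`, onto `S`, and with `sub ρ (Φ (M ρ)) ∧ M ρ ∈ Fs` whenever
every `sub`-predecessor of `ρ` lies in `Fs`. [this work] -/
def Natural (S : AntitheticLegStr Λ) : Prop :=
  ∀ (Db Dt Fs : Finset Λ),
    (∀ ρ ρ', S.ble ρ' ρ → ρ ∈ Db → ρ' ∈ Db) →
    (∀ σ σ', S.tle σ' σ → σ ∈ Dt → σ' ∈ Dt) →
    (∀ ρ σ, S.blt ρ σ → σ ∈ Dt → ρ ∈ Db) →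
    (∀ ρ ρ', S.ble ρ' ρ → ρ ∈ Fs → ρ' ∈ Fs) →
    (∀ ρ σ, σ ∈ Dt → S.blt ρ σ → ρ ∈ Fs) →
    Fs ⊆ Db →
    ∃ M : Λ → Λ,
      (∀ ρ, ρ ∈ Db → ρ ∉ Dt → (M ρ ∈ Db ∧ S.Φ (M ρ) ∉ Dt ∧ S.blt ρ (S.Φ (M ρ)))) ∧
      (∀ ρ ρ', ρ ∈ Db → ρ ∉ Dt → ρ' ∈ Db → ρ' ∉ Dt → M ρ = M ρ' → ρ = ρ') ∧
      (∀ s, s ∈ Db → S.Φ s ∉ Dt → ∃ ρ, ρ ∈ Db ∧ ρ ∉ Dt ∧ M ρ = s) ∧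
      (∀ ρ, ρ ∈ Db → ρ ∉ Dt → (∀ ρ', S.sub ρ' ρ → ρ' ∈ Fs) → (S.sub ρ (S.Φ (M ρ)) ∧ M ρ ∈ Fs))

/-- The HUB constructor (PROOF-RL-g43 P1″): labels `Bool × Λ′`; `(false, y)` ↔ `B_y`/`τ_y` (edge `g` blue), `(true, u)` ↔ `β_u`/`T_u` (`g` red).
Bottom order: cube on the `B`'s, the old bottom order on the `β`'s; top order: cube on the `T`'s, old top order on the `τ`'s; `B_y < T_{y′} ⟺ B_y < τ_{y′}
⟺ y ⊆ y′`, `β_u < T_y ⟺ u ⊆ y`, `β_u < τ_y ⟺` old relation; `Φ: B_y ↦ T_y, β_u ↦ τ_{Φ u}`. [this work] -/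
def hub (S' : AntitheticLegStr Λ) : AntitheticLegStr (Bool × Λ) where
  sub p q := (p.1 = false ∨ q.1 = true) ∧ S'.sub p.2 q.2
  ble p q := p.1 = q.1 ∧ (if p.1 = true then S'.ble p.2 q.2 else S'.sub p.2 q.2)
  tle p q := p.1 = q.1 ∧ (if p.1 = true then S'.sub p.2 q.2 else S'.tle p.2 q.2)
  blt p q := if p.1 = true then (if q.1 = true then S'.sub p.2 q.2 else S'.blt p.2 q.2) else S'.sub p.2 q.2
  Φ p := if p.1 = true then (false, S'.Φ p.2) else (true, p.2)

/-- The NECK constructor (PROOF-RL-g43 P1″): the layered product of two leg structures, everything componentwise. [this work] -/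
def neck {Λ₁ Λ₂ : Type*} (S₁ : AntitheticLegStr Λ₁) (S₂ : AntitheticLegStr Λ₂) : AntitheticLegStr (Λ₁ × Λ₂) where
  sub p q := S₁.sub p.1 q.1 ∧ S₂.sub p.2 q.2
  ble p q := S₁.ble p.1 q.1 ∧ S₂.ble p.2 q.2
  tle p q := S₁.tle p.1 q.1 ∧ S₂.tle p.2 q.2
  blt p q := S₁.blt p.1 q.1 ∧ S₂.blt p.2 q.2
  Φ p := (S₁.Φ p.1, S₂.Φ p.2)

/-- The BASE structure: the 2-chain `H(∅) = {b < t}` on the one-point label type (PROOF-RL-g43 P2, BASE). [this work] -/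
def leafStr : AntitheticLegStr Unit where
  sub _ _ := True
  ble _ _ := True
  tle _ _ := True
  blt _ _ := True
  Φ u := u

end AntitheticLegStr

end Summit.CriticalPhenomena.PercolationContinuityZ3.Theorems
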